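import Summits.Ventures.PercRepro.ProfileTwoAverage

/-!
# PercRepro — RANK-2 MATROIDS: at least `N − 1` independent pairs (a seed for `RankTwoHall`)
(p10, gen 4; `proofs/P10-HALLROW.md` §7, recipe (i)(a) of HANDOFF §p10 gen 4 ADDENDUM 3)

In a matroid of rank `2` with `N` non-loops there are at least `N − 1` independent pairs: fix an independent pair
`{x, y}`; every other non-loop `z` is non-parallel to `x` or to `y` (otherwise `x, y ∈ cl{z}` and `{x, y}` would
have rank `≤ 1`), so `z ↦ {x, z}` or `{y, z}` injects the other non-loops into the independent pairs other than
`{x, y}`.  Applied to `N ∖ C` this gives the hypothesis (G1) of `hall_disjoint_pairs` for `RankTwoHall` when the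
rank-2 matroid has `≥ 7` non-loops, and `#𝒞 ≥ N − 1` gives (G3).

* `nonLoops` — the non-loops (rank-1 singletons);
* `rk_pair_eq_one_iff` — `ρ{x, z} = 1 ↔ x ∈ cl{z}` for non-loops;
* `not_parallel_both` — a non-loop is non-parallel to `x` or to `y` when `ρ{x, y} = 2`;
* **`card_nonLoops_le_card_indepSets_two_add_one`** — `N ≤ #(independent pairs) + 1` in rank `2`.
-/

open scoped Matroid

namespace PercRepro.Cogirth

open Finset ThmH Skew Shadow Profile

variable {α : Type} [DecidableEq α] {M : Matroid α} [M.Finite] {x y z : α}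

/-- The non-loops of `M` (the elements of rank `1`). -/
noncomputable def nonLoops (M : Matroid α) [M.Finite] : Finset α := (gr M).filter (fun x => rk M {x} = 1)

omit [DecidableEq α] in
/-- Membership in `nonLoops`. -/
theorem mem_nonLoops {x : α} : x ∈ nonLoops M ↔ x ∈ gr M ∧ rk M {x} = 1 := by
  unfold nonLoops
  rw [mem_filter]

/-- For non-loops `x ≠ z`: `ρ{x, z} = 1 ↔ x ∈ cl{z}`, and otherwise `ρ{x, z} = 2`. -/
theorem rk_pair_eq (hx : x ∈ nonLoops M) (hz : z ∈ nonLoops M) :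
    rk M {x, z} = if x ∈ clF M {z} then 1 else 2 := by
  rw [mem_nonLoops] at hx hz
  have h := rk_insert_eq (M := M) hx.1 (X := {z}) (singleton_subset_iff.2 hz.1)
  rw [hz.2] at h
  exact h

/-- If `ρ{x, y} = 2` (`x, y` non-loops) then a non-loop `z` satisfies `ρ{x, z} = 2` or `ρ{y, z} = 2`. -/
theorem not_parallel_both (hx : x ∈ nonLoops M) (hy : y ∈ nonLoops M) (hz : z ∈ nonLoops M)
    (hxy : rk M {x, y} = 2) : rk M {x, z} = 2 ∨ rk M {y, z} = 2 := by
  by_contra hcon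
  rw [not_or] at hcon
  rw [rk_pair_eq hx hz] at hcon
  rw [rk_pair_eq hy hz] at hcon
  have hxc : x ∈ clF M {z} := by
    by_contra h
    rw [if_neg h] at hcon
    exact hcon.1 rfl
  have hyc : y ∈ clF M {z} := by
    by_contra h
    rw [if_neg h] at hcon
    exact hcon.2 rfl
  -- `{x, y} ⊆ cl{z}` so `ρ{x, y} ≤ ρ(cl{z}) = ρ{z} = 1`
  have hsub : ({x, y} : Finset α) ⊆ clF M {z} := by
    intro w hw
    rw [mem_insert, mem_singleton] at hw
    rcases hw with rfl | rfl
    · exact hxc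
    · exact hyc
  have h1 : rk M {x, y} ≤ rk M (clF M {z}) := rk_mono' hsub
  have h2 : rk M (clF M {z}) = rk M {z} := by
    unfold rk
    congr 1
    rw [coe_clF]
    exact M.eRk_closure_eq _
  rw [h2, (mem_nonLoops.1 hz).2] at h1
  omega

/-- **A rank-2 matroid with `N` non-loops has at least `N − 1` independent pairs.** -/
theorem card_nonLoops_le_card_indepSets_two_add_one (hR : rk M (gr M) = 2) :
    (nonLoops M).card ≤ (indepSets M 2).card + 1 := by
  -- a basis `{x, y}`
  obtain ⟨B, hBg, hBc, hBi⟩ := exists_basis_finset (M := M)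
  rw [hR] at hBc
  obtain ⟨x, y, hxy, rfl⟩ := card_eq_two.1 hBc
  have hx : x ∈ nonLoops M := by
    rw [mem_nonLoops]
    refine ⟨hBg (mem_insert_self _ _), ?_⟩
    rw [rk_eq_card_of_indep (hBi.subset (by exact_mod_cast (singleton_subset_iff.2 (mem_insert_self x {y}))))]
    exact card_singleton x
  have hy : y ∈ nonLoops M := by
    rw [mem_nonLoops]
    refine ⟨hBg (mem_insert_of_mem (mem_singleton_self y)), ?_⟩
    rw [rk_eq_card_of_indep (hBi.subset (by
      exact_mod_cast (singleton_subset_iff.2 (mem_insert_of_mem (mem_singleton_self y)))))]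
    exact card_singleton y
  have hxyr : rk M {x, y} = 2 := by
    rw [rk_eq_card_of_indep hBi, card_pair hxy]
  -- the injection from the other non-loops
  have hinj : ((nonLoops M) \ {x, y}).card ≤ ((indepSets M 2).erase {x, y}).card := by
    apply card_le_card_of_injOn (fun z => if rk M {x, z} = 2 then ({x, z} : Finset α) else {y, z})
    · intro z hz
      rw [Finset.mem_coe, mem_sdiff, mem_insert, mem_singleton, not_or] at hz
      have hzn := hz.1
      rw [Finset.mem_coe, mem_erase, mem_indepSets]
      simp only
      rcases not_parallel_both hx hy hzn hxyr with h | h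
      · rw [if_pos h]
        refine ⟨?_, ?_, card_pair (Ne.symm hz.2.1), indep_of_rk_eq_card (by rw [h, card_pair (Ne.symm hz.2.1)])⟩
        · intro h' 
          have : z ∈ ({x, y} : Finset α) := by rw [← h']; exact mem_insert_of_mem (mem_singleton_self z)
          rw [mem_insert, mem_singleton] at this
          rcases this with h1 | h1
          · exact hz.2.1 h1
          · exact hz.2.2 h1
        · intro w hw
          rw [mem_insert, mem_singleton] at hw
          rcases hw with rfl | rfl
          · exact (mem_nonLoops.1 hx).1
          · exact (mem_nonLoops.1 hzn).1
      · by_cases h' : rk M {x, z} = 2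
        · rw [if_pos h']
          refine ⟨?_, ?_, card_pair (Ne.symm hz.2.1), indep_of_rk_eq_card (by rw [h', card_pair (Ne.symm hz.2.1)])⟩
          · intro h''
            have : z ∈ ({x, y} : Finset α) := by rw [← h'']; exact mem_insert_of_mem (mem_singleton_self z)
            rw [mem_insert, mem_singleton] at this
            rcases this with h1 | h1
            · exact hz.2.1 h1
            · exact hz.2.2 h1
          · intro w hw
            rw [mem_insert, mem_singleton] at hw
            rcases hw with rfl | rfl
            · exact (mem_nonLoops.1 hx).1
            · exact (mem_nonLoops.1 hzn).1
        · rw [if_neg h']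
          refine ⟨?_, ?_, card_pair (Ne.symm hz.2.2), indep_of_rk_eq_card (by rw [h, card_pair (Ne.symm hz.2.2)])⟩
          · intro h''
            have : z ∈ ({x, y} : Finset α) := by rw [← h'']; exact mem_insert_of_mem (mem_singleton_self z)
            rw [mem_insert, mem_singleton] at this
            rcases this with h1 | h1
            · exact hz.2.1 h1
            · exact hz.2.2 h1
          · intro w hw
            rw [mem_insert, mem_singleton] at hw
            rcases hw with rfl | rfl
            · exact (mem_nonLoops.1 hy).1
            · exact (mem_nonLoops.1 hzn).1
    · intro z hz z' hz' h
      rw [Finset.mem_coe, mem_sdiff, mem_insert, mem_singleton, not_or] at hz hz'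
      simp only at h
      -- both images contain `z` resp. `z'` as their non-`x`/`y` element
      have key : ∀ (w : α) (s : Finset α), w ≠ x → w ≠ y → (s = {x, w} ∨ s = {y, w}) → (w ∈ s ∧ ∀ v ∈ s, v = w ∨ v = x ∨ v = y) := by
        intro w s hwx hwy hs
        rcases hs with rfl | rfl
        · refine ⟨mem_insert_of_mem (mem_singleton_self w), ?_⟩
          intro v hv; rw [mem_insert, mem_singleton] at hv; rcases hv with rfl | rfl
          · exact Or.inr (Or.inl rfl)
          · exact Or.inl rfl
        · refine ⟨mem_insert_of_mem (mem_singleton_self w), ?_⟩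
          intro v hv; rw [mem_insert, mem_singleton] at hv; rcases hv with rfl | rfl
          · exact Or.inr (Or.inr rfl)
          · exact Or.inl rfl
      have hs : (if rk M {x, z} = 2 then ({x, z} : Finset α) else {y, z}) = {x, z} ∨
          (if rk M {x, z} = 2 then ({x, z} : Finset α) else {y, z}) = {y, z} := by
        split_ifs <;> simp
      have hs' : (if rk M {x, z'} = 2 then ({x, z'} : Finset α) else {y, z'}) = {x, z'} ∨
          (if rk M {x, z'} = 2 then ({x, z'} : Finset α) else {y, z'}) = {y, z'} := by
        split_ifs <;> simp
      obtain ⟨hzmem, _⟩ := key z _ hz.2.1 hz.2.2 hs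
      obtain ⟨_, hall'⟩ := key z' _ hz'.2.1 hz'.2.2 hs'
      rw [h] at hzmem
      rcases hall' z hzmem with h1 | h1 | h1
      · exact h1
      · exact absurd h1 hz.2.1
      · exact absurd h1 hz.2.2
  have h1 : (nonLoops M \ {x, y}).card + 2 = (nonLoops M).card := by
    have hsub : ({x, y} : Finset α) ⊆ nonLoops M := by
      intro w hw
      rw [mem_insert, mem_singleton] at hw
      rcases hw with rfl | rfl
      · exact hx
      · exact hy
    rw [← card_pair hxy]
    exact card_sdiff_add_card_eq_card hsub
  have h2 : ((indepSets M 2).erase {x, y}).card + 1 = (indepSets M 2).card := by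
    apply card_erase_add_one
    rw [mem_indepSets]
    exact ⟨hBg, hBc, hBi⟩
  omega

end PercRepro.Cogirth
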